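import Literature.NumberTheory.EllipticCurves.IsogenyLocalPointsMaps
import Literature.NumberTheory.EllipticCurves.VariableChangePointsMap
import Literature.NumberTheory.EllipticCurves.QuadraticTwist
import Literature.NumberTheory.EllipticCurves.BSDInvariantsRegulatorProofs
import Literature.NumberTheory.EllipticCurves.HeegnerPointsGaloisDescent
import Literature.NumberTheory.EllipticCurves.HeightsBaseChangeProofs
import HarnessLib

/-!
# Crux U₁ `LeafRankOneUpperAtThree` (stmt-BirchSwinnertonDyer-26022), line `partnerdescent` — partner kernel part 10:
# the GENUS TRANSPORT `ψ_θ : V(L) ≃+ W(L)` over a field `L ∋ θ`, `θ² = −3`, and its SIGN RULE under field maps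

HONEST FRAMING (lead prover `bsd-line-rhp-p2` g57, explicit-unit seat, cell `bsd-wall`): a SUPPORT file for the registered stub (DISPLAY-L)
`stub_partnerGenusDisplayLabelledAtThree` of the line of record `partnerdescent` v4.3 on crux U₁ (mirror U₀, stmt-BirchSwinnertonDyer-26024). It
proves NO stub and closes NO item; BSD is proved for no curve. The stub's docstring says WHY it is print: the labelled `W`-family is the RE-SIGNED
genus-descended family `χ₋₃(m)·ψ⁻¹((1 − σ)·y_{3m}(V))`, where `ψ : W ≅ V` over `ℚ(√−3)` and the signs `(−3/ℓ)` in (B4)/(B5) and `ε_W = −ε_V` in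
(B3) come from ONE rule: `ψ` commutes with a field map that fixes `√−3` and ANTI-commutes with one that negates it. This file builds that
isomorphism from tree parts and proves exactly that rule, for ANY model `W/ℚ`, any `V = CV • W^{(−3)}` and any field `L ∋ θ` with `θ² = −3`:

* `genusTransport W C₁ hC₁ CV hV hθ : (V ⊗ L)(L) ≃+ (W ⊗ L)(L)` — the composite `V(L) = (CV • W₁^{(−3)})(L) ≃ W₁^{(−3)}(L) ≃ W₁(L) ≃ W(L)` of the
  tree's `VariableChange.pointEquivBaseChange` (a `ℚ`-rational substitution, twice) and `untwistEquivAt` (`(x, y) ↦ (x/θ², y/θ³)`, Silverman X.5.4 (iii))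
  through a completed-square model `W₁ = C₁ • W` (`a₁ = a₃ = 0`, e.g. `W₁ = W^{(1)}`, `exists_variableChange_quadraticTwist_one`);
* §2 `genusTransport_map_of_eq` ∕ `genusTransport_map_of_eq_neg` — for a `ℚ`-algebra map `f : L → L'` with `f θ = θ'` (resp. `f θ = −θ'`):
  `f_* ∘ ψ_θ = ψ_{θ'} ∘ f_*` (resp. `= −ψ_{θ'} ∘ f_*`);
* §3 the descent corollaries for an automorphism `σ` of `L` with `σ θ = −θ`: ANTI-invariant points of `V(L)` go to `σ`-FIXED points of `W(L)`
  (`map_genusTransport_eq_self_of_anti`) and fixed points to anti-invariant ones (`map_genusTransport_eq_neg_of_fixed`) — the mechanism by which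
  `(1 − σ)·y_{3m}(V) ∈ V(K[3m])^{−}` lands in `W(K[m])` (`K[3m] = K[m](√−3)`).

No new definition of mathematical content beyond the composite isomorphism (a `def` assembling tree equivalences); no named fact; no `sorry`.
-/

set_option linter.dupNamespace false
set_option autoImplicit false

noncomputable section

open scoped Classical

namespace Summit.BirchSwinnertonDyer.BirchSwinnertonDyer.Theorems.LeafPartnerGenusTransport

open WeierstrassCurve

universe v w

variable (W : WeierstrassCurve ℚ) {W₁ : WeierstrassCurve ℚ} [W₁.IsCharNeTwoNF] (C₁ : VariableChange ℚ) (hC₁ : C₁ • W = W₁)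
  {V : WeierstrassCurve ℚ} (CV : VariableChange ℚ) (hV : CV • W₁.quadraticTwist (-3) = V)
  {L : Type v} [Field L] [Algebra ℚ L] {θ : L}
  {L' : Type w} [Field L'] [Algebra ℚ L'] {θ' : L'}

/-! ## §1 The transport -/

/-- A square root of `−3` is non-zero. [folklore] -/
theorem theta_ne_zero (hθ : θ ^ 2 = algebraMap ℚ L (-3)) : θ ≠ 0 := by
  rintro rfl
  have h : (algebraMap ℚ L) (-3) = 0 := by rw [← hθ]; simp
  rw [map_eq_zero] at h
  norm_num at h

/-- **The twists of a completed-square model are the twists of the model**: `(W^{(1)})^{(d)} = W^{(d)}` (`quadraticTwist_quadraticTwist`,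
`1·d = d`) — so the consumer may take `W₁ = W^{(1)}` and `V = CV • W^{(−3)}` VERBATIM as in the stub. [cite: SilvermanAEC2009, X.5 Cor. 5.4] -/
theorem quadraticTwist_one_quadraticTwist (d : ℚ) : (W.quadraticTwist 1).quadraticTwist d = W.quadraticTwist d := by
  rw [quadraticTwist_quadraticTwist, one_mul]

/-- **The genus transport `ψ_θ : V(L) ≃+ W(L)`** for `V = CV • W₁^{(−3)}`, `W₁ = C₁ • W` a completed-square model, over a `ℚ`-field `L`
with a chosen `θ`, `θ² = −3`: undo the `ℚ`-substitution `CV`, untwist by `(x, y) ↦ (x/θ², y/θ³)`, undo the `ℚ`-substitution `C₁`.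
An isomorphism of groups defined over `L` (NOT over `ℚ`: it depends on the choice of `θ`, see §2). [cite: SilvermanAEC2009, X.5 Cor. 5.4 (iii), III.3.1 (b)] -/
def genusTransport (hθ : θ ^ 2 = algebraMap ℚ L (-3)) :
    (V.baseChange L).toAffine.Point ≃+ (W.baseChange L).toAffine.Point :=
  ((Affine.Point.congrEquiv (congrArg (fun X : WeierstrassCurve ℚ => X.baseChange L) hV)).symm.trans
    (VariableChange.pointEquivBaseChange (W₁.quadraticTwist (-3)) CV L).symm).trans
    ((untwistEquivAt W₁ hθ (theta_ne_zero hθ)).trans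
      ((Affine.Point.congrEquiv (congrArg (fun X : WeierstrassCurve ℚ => X.baseChange L) hC₁)).symm.trans
        (VariableChange.pointEquivBaseChange W C₁ L).symm))

/-! ## §2 The sign rule under field maps -/

omit [W₁.IsCharNeTwoNF] in
/-- Transport along `rfl` is the identity (definitional helper). [folklore] -/
theorem congrEquiv_refl_apply {F : Type v} [Field F] {X : WeierstrassCurve F} (P : X.toAffine.Point) :
    Affine.Point.congrEquiv (rfl : X = X) P = P := rfl

/-- **`ψ` commutes with a field map fixing the root**: for a `ℚ`-algebra map `f : L → L'` with `f θ = θ'` (`θ² = −3`, `θ'² = −3`) and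
`z ∈ V(L)`: `f_*(ψ_θ z) = ψ_{θ'}(f_* z)`. (The two `ℚ`-substitutions commute with `f_*` — `pointEquivBaseChange_symm_map` — and the
untwisting does when `f θ = θ'` — `map_untwistEquivAt_of_eq`.) [cite: SilvermanAEC2009, X.5 Cor. 5.4 (iii)] -/
theorem genusTransport_map_of_eq (hθ : θ ^ 2 = algebraMap ℚ L (-3)) (hθ' : θ' ^ 2 = algebraMap ℚ L' (-3))
    (f : L →ₐ[ℚ] L') (hf : f θ = θ') (z : (V.baseChange L).toAffine.Point) :
    Affine.Point.map f (genusTransport W C₁ hC₁ CV hV hθ z) = genusTransport W C₁ hC₁ CV hV hθ' (Affine.Point.map f z) := by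
  subst hV hC₁
  simp only [genusTransport, AddEquiv.trans_apply]
  show Affine.Point.map f ((VariableChange.pointEquivBaseChange W C₁ L).symm
      ((Affine.Point.congrEquiv rfl).symm (untwistEquivAt (C₁ • W) hθ (theta_ne_zero hθ)
        ((VariableChange.pointEquivBaseChange ((C₁ • W).quadraticTwist (-3)) CV L).symm ((Affine.Point.congrEquiv rfl).symm z))))) = _
  rw [VariableChange.pointEquivBaseChange_symm_map]
  congr 1
  show Affine.Point.map f (untwistEquivAt (C₁ • W) hθ (theta_ne_zero hθ)
      ((VariableChange.pointEquivBaseChange ((C₁ • W).quadraticTwist (-3)) CV L).symm z)) =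
    untwistEquivAt (C₁ • W) hθ' (theta_ne_zero hθ')
      ((VariableChange.pointEquivBaseChange ((C₁ • W).quadraticTwist (-3)) CV L').symm (Affine.Point.map f z))
  rw [map_untwistEquivAt_of_eq (C₁ • W) hθ (theta_ne_zero hθ) hθ' (theta_ne_zero hθ') f hf,
    VariableChange.pointEquivBaseChange_symm_map]

/-- **`ψ` ANTI-commutes with a field map negating the root**: for `f : L → L'` with `f θ = −θ'`: `f_*(ψ_θ z) = −ψ_{θ'}(f_* z)`
(`map_untwistEquivAt_of_eq_neg`; the substitutions are additive, so the sign passes through). This is the source of every sign in the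
stub's re-signed family: `a_ℓ(V) = (−3/ℓ)·a_ℓ(W)` in (B4), `ψ̃^{Frob_ℓ} = (−3/ℓ)ψ̃` in (B5), `ε_W = −ε_V` in (B3).
[cite: SilvermanAEC2009, X.5 Cor. 5.4 (iii)] -/
theorem genusTransport_map_of_eq_neg (hθ : θ ^ 2 = algebraMap ℚ L (-3)) (hθ' : θ' ^ 2 = algebraMap ℚ L' (-3))
    (f : L →ₐ[ℚ] L') (hf : f θ = -θ') (z : (V.baseChange L).toAffine.Point) :
    Affine.Point.map f (genusTransport W C₁ hC₁ CV hV hθ z) = -genusTransport W C₁ hC₁ CV hV hθ' (Affine.Point.map f z) := by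
  subst hV hC₁
  simp only [genusTransport, AddEquiv.trans_apply]
  show Affine.Point.map f ((VariableChange.pointEquivBaseChange W C₁ L).symm
      ((Affine.Point.congrEquiv rfl).symm (untwistEquivAt (C₁ • W) hθ (theta_ne_zero hθ)
        ((VariableChange.pointEquivBaseChange ((C₁ • W).quadraticTwist (-3)) CV L).symm ((Affine.Point.congrEquiv rfl).symm z))))) = _
  rw [VariableChange.pointEquivBaseChange_symm_map, ← map_neg]
  congr 1
  show Affine.Point.map f (untwistEquivAt (C₁ • W) hθ (theta_ne_zero hθ)
      ((VariableChange.pointEquivBaseChange ((C₁ • W).quadraticTwist (-3)) CV L).symm z)) =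
    -untwistEquivAt (C₁ • W) hθ' (theta_ne_zero hθ')
      ((VariableChange.pointEquivBaseChange ((C₁ • W).quadraticTwist (-3)) CV L').symm (Affine.Point.map f z))
  rw [map_untwistEquivAt_of_eq_neg (C₁ • W) hθ (theta_ne_zero hθ) hθ' (theta_ne_zero hθ') f hf,
    VariableChange.pointEquivBaseChange_symm_map]

/-! ## §3 Descent corollaries for an automorphism negating `θ` -/

/-- **Anti-invariant in `V(L)` ⇒ fixed in `W(L)`.** If `σ : L → L` is a `ℚ`-algebra map with `σ θ = −θ` and `z ∈ V(L)` satisfies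
`σ_* z = −z`, then `σ_*(ψ_θ z) = ψ_θ z`. (On the line: `L = K[3m] = K[m](√−3)`, `σ` the generator of `Gal(K[3m]/K[m])`, `z = (1 − σ)·y_{3m}(V)`;
the image is then a `K[m]`-point of `W` by Galois descent.) [cite: SilvermanAEC2009, X.5 Cor. 5.4 (iii)] -/
theorem map_genusTransport_eq_self_of_anti (hθ : θ ^ 2 = algebraMap ℚ L (-3)) (σ : L →ₐ[ℚ] L) (hσ : σ θ = -θ)
    (z : (V.baseChange L).toAffine.Point) (hz : Affine.Point.map σ z = -z) :
    Affine.Point.map σ (genusTransport W C₁ hC₁ CV hV hθ z) = genusTransport W C₁ hC₁ CV hV hθ z := by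
  rw [genusTransport_map_of_eq_neg W C₁ hC₁ CV hV hθ hθ σ hσ, hz, map_neg, neg_neg]

/-- **Fixed in `V(L)` ⇒ anti-invariant in `W(L)`**: if `σ θ = −θ` and `σ_* z = z` then `σ_*(ψ_θ z) = −ψ_θ z` (e.g. the `L₀`-points of `V`
go to the `χ₋₃`-anti-invariant points of `W`). [cite: SilvermanAEC2009, X.5 Cor. 5.4 (iii)] -/
theorem map_genusTransport_eq_neg_of_fixed (hθ : θ ^ 2 = algebraMap ℚ L (-3)) (σ : L →ₐ[ℚ] L) (hσ : σ θ = -θ)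
    (z : (V.baseChange L).toAffine.Point) (hz : Affine.Point.map σ z = z) :
    Affine.Point.map σ (genusTransport W C₁ hC₁ CV hV hθ z) = -genusTransport W C₁ hC₁ CV hV hθ z := by
  rw [genusTransport_map_of_eq_neg W C₁ hC₁ CV hV hθ hθ σ hσ, hz]

/-- **Fixed under a root-FIXING map**: if `τ θ = θ` and `τ_* z = z` then `τ_*(ψ_θ z) = ψ_θ z` (maps of `L` fixing `√−3` act on the
transported family exactly as on the original one). [cite: SilvermanAEC2009, X.5 Cor. 5.4 (iii)] -/
theorem map_genusTransport_eq_self_of_fixed (hθ : θ ^ 2 = algebraMap ℚ L (-3)) (τ : L →ₐ[ℚ] L) (hτ : τ θ = θ)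
    (z : (V.baseChange L).toAffine.Point) (hz : Affine.Point.map τ z = z) :
    Affine.Point.map τ (genusTransport W C₁ hC₁ CV hV hθ z) = genusTransport W C₁ hC₁ CV hV hθ z := by
  rw [genusTransport_map_of_eq W C₁ hC₁ CV hV hθ hθ τ hτ, hz]

/-- **Torsion is preserved** (ψ is an isomorphism of groups): `ψ_θ z` has finite order iff `z` does — so the torsion clauses (B3)-type
statements transport verbatim. [folklore] -/
theorem isOfFinAddOrder_genusTransport_iff (hθ : θ ^ 2 = algebraMap ℚ L (-3)) (z : (V.baseChange L).toAffine.Point) :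
    IsOfFinAddOrder (genusTransport W C₁ hC₁ CV hV hθ z) ↔ IsOfFinAddOrder z :=
  (genusTransport W C₁ hC₁ CV hV hθ).injective.isOfFinAddOrder_iff (f := (genusTransport W C₁ hC₁ CV hV hθ).toAddMonoidHom)

/-! ## §4 (appended) Heights: `ψ_θ` preserves the canonical height over `L` -/

omit [W₁.IsCharNeTwoNF] in
/-- Transport along an equality of equations preserves the canonical height (it is the identity on coordinates). [folklore] -/
theorem canonicalHeight_congrEquiv {F : Type v} [Field F] [Height.AdmissibleAbsValues F] {X Y : WeierstrassCurve F} (h : X = Y)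
    (P : X.toAffine.Point) : (Affine.Point.congrEquiv h P).canonicalHeight = P.canonicalHeight := by
  subst h
  rfl

omit [W₁.IsCharNeTwoNF] in
/-- The substitution `W(L) ≃+ (C • W)(L)` of a `ℚ`-rational change of variables preserves the canonical height over `L`
(`canonicalHeight_pointEquiv`, Silverman VIII.9.1 independence of the equation), and so does its inverse. [cite: SilvermanAEC2009, Prop. VIII.9.1] -/
theorem canonicalHeight_pointEquivBaseChange_symm [Height.AdmissibleAbsValues L] (X : WeierstrassCurve ℚ) (C : VariableChange ℚ)
    (Q : ((C • X).baseChange L).toAffine.Point) :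
    ((VariableChange.pointEquivBaseChange X C L).symm Q).canonicalHeight = Q.canonicalHeight := by
  set P := (VariableChange.pointEquivBaseChange X C L).symm Q with hP
  have hQ : Q = VariableChange.pointEquivBaseChange X C L P := by rw [hP, AddEquiv.apply_symm_apply]
  rw [hQ]
  show P.canonicalHeight = (Affine.Point.congrEquiv (VariableChange.baseChange_smul_eq X C L).symm
    (VariableChange.pointEquiv (X.baseChange L) (C.map (algebraMap ℚ L)) P)).canonicalHeight
  rw [canonicalHeight_congrEquiv, Affine.Point.canonicalHeight_pointEquiv]

/-- **`ĥ_L(ψ_θ z) = ĥ_L(z)`**: the genus transport preserves the canonical height over `L` (each of its three steps is a change of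
variables over `L`, Silverman VIII.9.1). With `ĥ_L = [L:K]·ĥ_K` (`canonicalHeight_baseChange`) this is the height bookkeeping of the
stub's display: the height of the genus component of `V` over `K(√−3)` is twice the height over `K` of its transport in `W(K)`.
[cite: SilvermanAEC2009, Prop. VIII.9.1] -/
theorem canonicalHeight_genusTransport [Height.AdmissibleAbsValues L] (hθ : θ ^ 2 = algebraMap ℚ L (-3))
    (z : (V.baseChange L).toAffine.Point) :
    (genusTransport W C₁ hC₁ CV hV hθ z).canonicalHeight = z.canonicalHeight := by
  subst hV hC₁
  simp only [genusTransport, AddEquiv.trans_apply]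
  rw [canonicalHeight_pointEquivBaseChange_symm]
  show (Affine.Point.congrEquiv rfl (untwistEquivAt (C₁ • W) hθ (theta_ne_zero hθ)
      ((VariableChange.pointEquivBaseChange ((C₁ • W).quadraticTwist (-3)) CV L).symm ((Affine.Point.congrEquiv rfl).symm z)))).canonicalHeight = _
  rw [canonicalHeight_congrEquiv]
  show (Affine.Point.congrEquiv (untwistAt_smul_eq (C₁ • W) hθ (theta_ne_zero hθ))
      (VariableChange.pointEquiv _ (untwistAt (theta_ne_zero hθ))
        ((VariableChange.pointEquivBaseChange ((C₁ • W).quadraticTwist (-3)) CV L).symm z))).canonicalHeight = _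
  rw [canonicalHeight_congrEquiv, Affine.Point.canonicalHeight_pointEquiv, canonicalHeight_pointEquivBaseChange_symm]

/-! ## §5 (appended) Galois descent of the transported point over a Galois extension `E/k`, with heights -/

section Descent

variable {k : Type v} {E : Type v} [Field k] [CharZero k] [Field E] [CharZero E] [Algebra k E] [IsScalarTower ℚ k E] {ϑ : E}

omit [W₁.IsCharNeTwoNF] in
/-- `Point.map` of a `k`-automorphism of `E` viewed over `ℚ` or over `k` is the same map (it acts on coordinates). [folklore] -/
theorem map_restrictScalars_rat (τ : E ≃ₐ[k] E) (P : (W.baseChange E).toAffine.Point) :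
    Affine.Point.map ((τ : E →ₐ[k] E).restrictScalars ℚ) P = Affine.Point.map (τ : E →ₐ[k] E) P := by
  rcases P with _ | ⟨x, y, h⟩ <;> rfl

omit [W₁.IsCharNeTwoNF] in
/-- A `k`-automorphism of `E` fixes or negates a square root of `−3` (`(τϑ)² = −3 = ϑ²`). [folklore] -/
theorem apply_theta_eq_or_eq_neg (hϑ : ϑ ^ 2 = algebraMap ℚ E (-3)) (τ : E ≃ₐ[k] E) : τ ϑ = ϑ ∨ τ ϑ = -ϑ := by
  have h : (τ ϑ) ^ 2 = ϑ ^ 2 := by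
    rw [← map_pow, hϑ, IsScalarTower.algebraMap_apply ℚ k E (-3), AlgEquiv.commutes]
  exact sq_eq_sq_iff_eq_or_eq_neg.mp h

/-- **Galois descent of the genus transport.** Let `E/k` be Galois (in practice quadratic, `E = k(√−3)`), `ϑ ∈ E`, `ϑ² = −3`, and
`z ∈ V(E)` a point FIXED by the `k`-automorphisms of `E` fixing `ϑ` and NEGATED by those negating it (on the line: `z = (1 − σ)·y_{3m}(V)`,
`k = K[m]`, `E = K[3m]`). Then `ψ_ϑ z ∈ W(E)` is fixed by all of `Gal(E/k)` (§3), hence is the base change of a point `P₀ ∈ W(k)`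
(tree `exists_map_eq_of_forall_map_galois_eq`). [cite: SilvermanAEC2009, X.5 Cor. 5.4 (iii), VIII.§1] -/
theorem exists_point_map_eq_genusTransport [IsGalois k E] (hϑ : ϑ ^ 2 = algebraMap ℚ E (-3))
    (z : (V.baseChange E).toAffine.Point)
    (hfix : ∀ τ : E ≃ₐ[k] E, τ ϑ = ϑ → Affine.Point.map (τ : E →ₐ[k] E) z = z)
    (hanti : ∀ τ : E ≃ₐ[k] E, τ ϑ = -ϑ → Affine.Point.map (τ : E →ₐ[k] E) z = -z) :
    ∃ P₀ : (W.baseChange k).toAffine.Point,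
      Affine.Point.map (algebraMap k E).toRatAlgHom P₀ = genusTransport W C₁ hC₁ CV hV hϑ z := by
  refine Literature.NumberTheory.EllipticCurves.exists_map_eq_of_forall_map_galois_eq (k := k) (L := E) W fun τ => ?_
  rw [← map_restrictScalars_rat W τ]
  rcases apply_theta_eq_or_eq_neg hϑ τ with h | h
  · refine map_genusTransport_eq_self_of_fixed W C₁ hC₁ CV hV hϑ _ h z ?_
    rw [map_restrictScalars_rat V τ]
    exact hfix τ h
  · refine map_genusTransport_eq_self_of_anti W C₁ hC₁ CV hV hϑ _ h z ?_
    rw [map_restrictScalars_rat V τ]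
    exact hanti τ h

omit [IsScalarTower ℚ k E] in
/-- **Heights in the descent**: with `E/k` number fields (`E = k(√−3)` on the line) and the descended point `P₀ ∈ W(k)` of
`exists_point_map_eq_genusTransport` (`(P₀)_E = ψ_ϑ z`): `[k:ℚ]·ĥ_E(z) = [E:ℚ]·ĥ_k(P₀)`, i.e. `ĥ_E(z) = [E:k]·ĥ_k(P₀)` (`= 2ĥ_k(P₀)` in the
quadratic case) — `ĥ_E(ψ_ϑ z) = ĥ_E(z)` (§4) and the tree's `canonicalHeight_map`. This is the height bookkeeping between the Cai–Shu–Tian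
display of the genus component of `V` over `K(√−3)` and the height over `K` of the displayed point of `W` in the stub.
[cite: SilvermanAEC2009, Prop. VIII.9.1, VIII.5.4 (b)] -/
theorem finrank_mul_canonicalHeight_eq_of_map_eq_genusTransport [NumberField k] [NumberField E] [W.IsElliptic]
    (hϑ : ϑ ^ 2 = algebraMap ℚ E (-3)) (z : (V.baseChange E).toAffine.Point) (P₀ : (W.baseChange k).toAffine.Point)
    (hP₀ : Affine.Point.map (algebraMap k E).toRatAlgHom P₀ = genusTransport W C₁ hC₁ CV hV hϑ z) :
    (Module.finrank ℚ k : ℝ) * z.canonicalHeight = Module.finrank ℚ E * P₀.canonicalHeight := by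
  rw [← canonicalHeight_genusTransport W C₁ hC₁ CV hV hϑ z, ← hP₀]
  exact Affine.Point.canonicalHeight_map (algebraMap k E).toRatAlgHom P₀

end Descent


/-! ## §6 (appended) The genus sign at a prime `ℓ`: Euler's criterion for a square root of `−3` in characteristic `ℓ` -/

omit [W₁.IsCharNeTwoNF] in
/-- **`θ̄^ℓ = (−3/ℓ)·θ̄` in characteristic `ℓ`.** For an odd prime `ℓ`, a field `F` of characteristic `ℓ` and `θ ∈ F` with `θ² = −3`:
`θ^ℓ = (−3/ℓ)·θ` (Legendre symbol; Euler's criterion `legendreSym.eq_pow`). This is the sign by which the `ℓ`-Frobenius moves the reduction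
of `√−3`, hence (with `genusTransport_map_of_eq(_neg)`) the sign `(−3/ℓ)` in the congruence label (B5) of the re-signed family — and, through
`a_ℓ(W) = (−3/ℓ)·a_ℓ(V)` (tree `LFunction_quadraticTwist_apply_of_emod_four_eq_one`), in the norm label (B4). [folklore] -/
theorem pow_prime_eq_legendreSym_mul {F : Type v} [Field F] (ℓ : ℕ) [Fact ℓ.Prime] [CharP F ℓ] (hℓ : ℓ ≠ 2)
    {ϑ : F} (hϑ : ϑ ^ 2 = -3) : ϑ ^ ℓ = ((legendreSym ℓ (-3) : ℤ) : F) * ϑ := by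
  have hodd : ℓ % 2 = 1 := Nat.odd_iff.mp ((Fact.out : ℓ.Prime).odd_of_ne_two hℓ)
  have key : ((legendreSym ℓ (-3) : ℤ) : F) = (-3 : F) ^ (ℓ / 2) := by
    have h := congrArg (ZMod.castHom (dvd_refl ℓ) F) (legendreSym.eq_pow ℓ (-3))
    rw [map_intCast, map_pow, map_intCast] at h
    rw [h]
    push_cast
    ring
  rw [key, ← hϑ, ← pow_mul, ← pow_succ]
  congr 1
  omega

end Summit.BirchSwinnertonDyer.BirchSwinnertonDyer.Theorems.LeafPartnerGenusTransport

end
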